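import Summits.ValiantsHypothesis.ValiantsHypothesis.Theses.RefutationDegree
import Summits.ValiantsHypothesis.ValiantsHypothesis.Theorems.RefutationDegreeMrCalibrationLinComb
import Summits.ValiantsHypothesis.ValiantsHypothesis.Theorems.RefutationDegreeMrCalibrationDivides

/-!
# Route `RefutationDegree`, item `MrCalibration` (stmt-ValiantsHypothesis-5647):
# the Mignon–Ressayre bound is a Nullstellensatz refutation of degree `O(m²)`

`mrCalibration_proof : MrCalibration` — for `n ≥ 3` and `2m + 1 ≤ n²` the system `Rep(n,m)`
("`per_n(x) = det (A₀ + Σ_e x_e A_e)` identically", unknowns the entries `a` of `A₀, A_e`, equations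
the `x`-coefficients of the defect `P = det A(x) − per_n(x) ∈ R[x]`, `R = ℂ[a]`) has a
Nullstellensatz refutation `Σ_μ h_μ · coeff_μ P = 1` with `deg (h_μ · coeff_μ P) ≤ 3 (m + 1)²`
(in fact `≤ 2m² + m`).

## Proof (the Mignon–Ressayre argument, read as an identity in `R`)

Write `LC_d` for the set of `Σ_μ h_μ coeff_μ P` with `deg h_μ ≤ d` (file `…LinComb`). Let
`y₀` be the Mignon–Ressayre point (`per(y₀) = 0`, `eval_mrPoint_perPoly`) and `B = A(y₀) ∈ R^{m×m}`.
* `det B = P(y₀) ∈ LC_0` (`eval_defect`, `lc_eval_defect`).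
* The Hessian `H_P = H(P(X + y₀))(0)` has entries in `LC_0` (`lc_hess0_transl_defect`) and equals
  `H_D − H_per`, `H_D = H(det A(X + y₀))(0) ∈ R^{n²×n²}` (entries of degree `≤ m`),
  `H_per = m'! · mrHess` the Hessian of the permanent at `y₀` (`hess0_transl_mrPoint_perPoly`),
  which is invertible (`mrHess_mulVec_injective`, Landsberg 2017, Lemma 6.4.6.3); pick a non-zero
  `(2m+1) × (2m+1)` minor `M` of `H_per` (`exists_submatrix_det_ne_zero`).
* Piece A: the same minor `M_D` of `H_D` satisfies `M_D − M ∈ LC_{2m²}` (`lc_det_sub_det`).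
* Piece B: `M_D = det B · Q` with `deg Q ≤ 2m²` (`exists_minor_eq_det_evalA_mul`, file `…Divides`:
  `det B` is prime and the Hessian of a determinant of affine forms vanishing at the origin has
  rank `≤ 2m` over the field `Frac(R/(det B))`, `rank_hess0_det_le`), so `M_D ∈ LC_{2m²}`.
Hence `M ∈ LC_{2m²}`, `1 = M⁻¹ M ∈ LC_{2m²}`, and `deg coeff_μ P ≤ m` (`coeffDeg_defect`) gives
products of degree `≤ 2m² + m ≤ 3(m+1)²`.

References: T. Mignon, N. Ressayre, IMRN 2004, Thm. 1.1; J. M. Landsberg, *Geometry and Complexity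
Theory* (2017), §6.4.5–6.4.6; Cai–Chen–Li 2010 (the same certificate in characteristic `≠ 2`, not
formalised).
-/

noncomputable section

-- single-conjunct layout: Sub = Summit, duplicated namespace component intended
set_option linter.dupNamespace false

namespace Summit.ValiantsHypothesis.ValiantsHypothesis.Theorems

open MvPolynomial Matrix Literature.Computability.AlgebraicComplexity RefutationDegreeMrCalibration

section Main

variable {n m : ℕ}

/-- The generic pencil `A(x) = A₀ + Σ_e x_e A_e` with unknown entries (local notation; the item's
statement inlines it). -/
local notation3 (prettyPrint := false) "genA[" n ", " m "]" => (Matrix.of fun i j : Fin m =>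
    MvPolynomial.C (MvPolynomial.X (none, (i, j))) +
      ∑ e : Fin n × Fin n, MvPolynomial.X e * MvPolynomial.C (MvPolynomial.X (some e, (i, j))) :
  Matrix (Fin m) (Fin m) (MvPolynomial (Fin n × Fin n)
    (MvPolynomial (Option (Fin n × Fin n) × (Fin m × Fin m)) ℂ)))

/-- The value `B = A(y)` of the pencil at a point `y` (local notation). -/
local notation3 (prettyPrint := false) "evalA[" n ", " m ", " y "]" => (Matrix.of fun i j : Fin m =>
    MvPolynomial.X (none, (i, j)) +
      ∑ e : Fin n × Fin n, MvPolynomial.C (y e) * MvPolynomial.X (some e, (i, j)) :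
  Matrix (Fin m) (Fin m) (MvPolynomial (Option (Fin n × Fin n) × (Fin m × Fin m)) ℂ))

/-- The point `y` with coordinates read in the coefficient ring `R = ℂ[a]` (local notation). -/
local notation3 (prettyPrint := false) "Cpt[" n ", " m ", " y "]" => (fun e : Fin n × Fin n =>
  (MvPolynomial.C (y e) : MvPolynomial (Option (Fin n × Fin n) × (Fin m × Fin m)) ℂ))

/-- The defect `P = det A(x) - per_n(x) ∈ R[x]` of the system `Rep(n,m)` (local notation; the
item's statement inlines it). -/
local notation3 (prettyPrint := false) "defect[" n ", " m "]" =>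
  ((genA[n, m]).det - MvPolynomial.map MvPolynomial.C
    (Literature.Computability.AlgebraicComplexity.perPoly (Fin n) ℂ))

/-- `LC[P, d, f]`: `f = Σ_{μ ∈ supp P} h_μ · coeff_μ P` with `deg h_μ ≤ d` (local notation, as in
the file `…LinComb`). -/
local notation3 (prettyPrint := false) "LC[" P ", " d ", " f "]" =>
  ∃ h : (Fin _ × Fin _ →₀ ℕ) → MvPolynomial (Option (Fin _ × Fin _) × (Fin _ × Fin _)) ℂ,
    (∀ μ, MvPolynomial.totalDegree (h μ) ≤ d) ∧
    (∑ μ ∈ MvPolynomial.support P, h μ * MvPolynomial.coeff μ P) = f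

/-- The equations of `Rep(n,m)` have degree `≤ m` in the unknowns: `coeff_μ det A(x)` is
homogeneous of degree `m` and the coefficients of `per_n` are constants. [folklore] -/
theorem coeffDeg_defect (μ : Fin n × Fin n →₀ ℕ) : (coeff μ defect[n, m]).totalDegree ≤ m :=
  coeffDeg_sub (fun ν => coeffDeg_det_genA ν)
    (fun ν => (coeffDeg_map_C _ ν).trans (Nat.zero_le _)) μ

/-- `P(y) = det A(y) - per_n(y)` for a point `y ∈ ℂ^{n × n}` (read in `R`). [folklore] -/
theorem eval_defect (y : Fin n × Fin n → ℂ) :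
    eval Cpt[n, m, y] defect[n, m] = (evalA[n, m, y]).det - C (eval y (perPoly (Fin n) ℂ)) := by
  rw [map_sub, eval_genA_det, eval_map]
  congr 1
  have h := eval₂_comp_left (C : ℂ →+* MvPolynomial (Option (Fin n × Fin n) × (Fin m × Fin m)) ℂ)
    (RingHom.id ℂ) y (perPoly (Fin n) ℂ)
  rw [RingHom.comp_id] at h
  exact h.symm

/-- `P(y)` is a degree-`0` combination of the equations: `P(y) = Σ_μ y^μ · coeff_μ P`. [folklore] -/
theorem lc_eval_defect (y : Fin n × Fin n → ℂ) :
    LC[defect[n, m], 0, eval Cpt[n, m, y] defect[n, m]] := by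
  rw [eval_eq]
  have hre : (∑ d ∈ (defect[n, m]).support, coeff d defect[n, m] *
        ∏ i ∈ d.support, Cpt[n, m, y] i ^ d i) =
      ∑ d ∈ (defect[n, m]).support, (∏ i ∈ d.support, Cpt[n, m, y] i ^ d i) *
        coeff d defect[n, m] :=
    Finset.sum_congr rfl fun d _ => mul_comm _ _
  rw [hre]
  refine lc_of_coeffs _ _ fun μ => ?_
  have hC : (∏ i ∈ μ.support, Cpt[n, m, y] i ^ μ i) = C (∏ i ∈ μ.support, y i ^ μ i) := by
    rw [map_prod]
    exact Finset.prod_congr rfl fun i _ => (map_pow C (y i) (μ i)).symm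
  rw [hC, totalDegree_C]

/-- The Hessian of the defect at a point splits as `H_P = H_D - H_per` with
`H_D = H(det A(X + y))(0)` and `H_per` the (constant) Hessian of the permanent at `y`. [folklore] -/
theorem hess0_transl_defect (y : Fin n × Fin n → ℂ) :
    hess0 (transl Cpt[n, m, y] defect[n, m]) =
      hess0 (transl Cpt[n, m, y] (genA[n, m]).det) -
        (hess0 (transl y (perPoly (Fin n) ℂ))).map C := by
  rw [map_sub, map_sub]
  congr 1
  rw [← hess0_map, map_transl]
  rfl

/-- The entries of the Hessian `H_P = H(P(X + y))(0)` of the defect are degree-`0` combinations of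
the equations (they are `ℂ`-linear combinations of the coefficients of `P`). [folklore] -/
theorem lc_hess0_transl_defect (y : Fin n × Fin n → ℂ) (e f : Fin n × Fin n) :
    LC[defect[n, m], 0, hess0 (transl Cpt[n, m, y] defect[n, m]) e f] := by
  rw [hess0_transl_eq_sum, Matrix.sum_apply]
  have hre : (∑ μ ∈ (defect[n, m]).support,
        (coeff μ defect[n, m] • hess0 (transl Cpt[n, m, y] (monomial μ 1))) e f) =
      ∑ μ ∈ (defect[n, m]).support,
        hess0 (transl Cpt[n, m, y] (monomial μ 1)) e f * coeff μ defect[n, m] := by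
    refine Finset.sum_congr rfl fun μ _ => ?_
    rw [Matrix.smul_apply, smul_eq_mul, mul_comm]
  rw [hre]
  refine lc_of_coeffs _ _ fun μ => ?_
  have hmap : hess0 (transl Cpt[n, m, y] (monomial μ (1 : MvPolynomial _ ℂ))) =
      (hess0 (transl y (monomial μ (1 : ℂ)))).map C :=
    hess0_transl_monomial_map (C : ℂ →+* MvPolynomial (Option (Fin n × Fin n) × (Fin m × Fin m)) ℂ)
      y μ
  rw [hmap, Matrix.map_apply, totalDegree_C]

/-- The certificate for `n = m' + 3`: a Nullstellensatz refutation of `Rep(m'+3, m)` with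
products of degree `≤ 3 (m + 1)²`, for `2m + 1 ≤ (m'+3)²` (the Mignon–Ressayre argument read as a
polynomial identity in `R = ℂ[a]`; module docstring). [cite: MignonRessayre2004, Thm. 1.1] -/
theorem mrCalibration_aux (m' m : ℕ) (hmn : 2 * m + 1 ≤ (m' + 3) ^ 2) :
    ∃ hh : (Fin (m' + 3) × Fin (m' + 3) →₀ ℕ) →
        MvPolynomial (Option (Fin (m' + 3) × Fin (m' + 3)) × (Fin m × Fin m)) ℂ,
      (∀ μ, (hh μ * (defect[m' + 3, m]).coeff μ).totalDegree ≤ 3 * (m + 1) ^ 2) ∧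
        ∑ μ ∈ (defect[m' + 3, m]).support, hh μ * (defect[m' + 3, m]).coeff μ = 1 := by
  classical
  -- the Hessian of the permanent at the Mignon–Ressayre point and a non-zero `(2m+1)`-minor
  have hHperU : IsUnit (hess0 (transl (mrPoint ℂ m') (perPoly (Fin (m' + 3)) ℂ))) := by
    rw [hess0_transl_mrPoint_perPoly, Matrix.isUnit_iff_isUnit_det, Matrix.det_smul,
      isUnit_iff_ne_zero]
    refine mul_ne_zero (pow_ne_zero _ (by exact_mod_cast Nat.factorial_ne_zero m')) ?_
    exact ((Matrix.isUnit_iff_isUnit_det _).mp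
      (Matrix.mulVec_injective_iff_isUnit.mp mrHess_mulVec_injective)).ne_zero
  have hcard : 2 * m + 1 ≤ Fintype.card (Fin (m' + 3) × Fin (m' + 3)) := by
    rw [Fintype.card_prod, Fintype.card_fin, ← sq]
    exact hmn
  obtain ⟨r, c, hM⟩ := exists_submatrix_det_ne_zero _ hHperU hcard
  -- notation: the two minors with polynomial entries
  obtain ⟨Xm, hX⟩ : ∃ Xm, Xm =
      (hess0 (transl Cpt[m' + 3, m, mrPoint ℂ m'] (genA[m' + 3, m]).det)).submatrix r c :=
    ⟨_, rfl⟩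
  obtain ⟨Ym, hY⟩ : ∃ Ym, Ym =
      ((hess0 (transl (mrPoint ℂ m') (perPoly (Fin (m' + 3)) ℂ))).submatrix r c).map
        (C : ℂ →+* MvPolynomial (Option (Fin (m' + 3) × Fin (m' + 3)) × (Fin m × Fin m)) ℂ) :=
    ⟨_, rfl⟩
  have hYdet : Ym.det =
      C ((hess0 (transl (mrPoint ℂ m') (perPoly (Fin (m' + 3)) ℂ))).submatrix r c).det := by
    rw [hY, RingHom.map_det, RingHom.mapMatrix_apply]
  -- Piece A: `det Xm - det Ym ∈ LC_{2m²}`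
  have hA : LC[defect[m' + 3, m], 2 * m * m, Xm.det - Ym.det] := by
    refine lc_det_sub_det _ Xm Ym (d := m) (fun i j => ?_) (fun i j => ?_) (fun i j => ?_)
    · rw [hX, Matrix.submatrix_apply]
      exact totalDegree_hessD_le _ _ _
    · rw [hY, Matrix.map_apply, totalDegree_C]
      exact Nat.zero_le _
    · have h := lc_hess0_transl_defect (n := m' + 3) (m := m) (mrPoint ℂ m') (r i) (c j)
      rw [hess0_transl_defect, Matrix.sub_apply, Matrix.map_apply] at h
      rw [hX, hY, Matrix.submatrix_apply, Matrix.map_apply, Matrix.submatrix_apply]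
      exact h
  -- Piece B: `det Xm = det B · Q ∈ LC_{2m²}`
  obtain ⟨Q, hQdeg, hQ⟩ :=
    exists_minor_eq_det_evalA_mul (n := m' + 3) (m := m) (mrPoint ℂ m') r c
  have hB : LC[defect[m' + 3, m], 0, (evalA[m' + 3, m, mrPoint ℂ m']).det] := by
    have h := lc_eval_defect (n := m' + 3) (m := m) (mrPoint ℂ m')
    rw [eval_defect, eval_mrPoint_perPoly, map_zero, sub_zero] at h
    exact h
  have hXdet : LC[defect[m' + 3, m], 2 * m * m, Xm.det] := by
    have h := lc_mul (d' := 2 * m * m) _ Q hQdeg hB (Nat.add_zero _).le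
    rw [hX, hQ, mul_comm _ Q]
    exact h
  -- conclusion: `det Ym = C M ∈ LC_{2m²}`, `1 = M⁻¹ M`
  have hYlc : LC[defect[m' + 3, m], 2 * m * m, Ym.det] := by
    have h := lc_sub _ hXdet hA
    rwa [sub_sub_cancel] at h
  have hone : LC[defect[m' + 3, m], 2 * m * m,
      (1 : MvPolynomial (Option (Fin (m' + 3) × Fin (m' + 3)) × (Fin m × Fin m)) ℂ)] := by
    have h := lc_mul (d' := 2 * m * m) _
      (C ((hess0 (transl (mrPoint ℂ m') (perPoly (Fin (m' + 3)) ℂ))).submatrix r c).det⁻¹)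
      (totalDegree_C _).le hYlc (Nat.zero_add _).le
    rw [hYdet, ← map_mul, inv_mul_cancel₀ hM, map_one] at h
    exact h
  obtain ⟨h, hdeg, hsum⟩ := hone
  refine ⟨h, fun μ => ?_, hsum⟩
  calc (h μ * coeff μ defect[m' + 3, m]).totalDegree
        ≤ (h μ).totalDegree + (coeff μ defect[m' + 3, m]).totalDegree := totalDegree_mul _ _
    _ ≤ 2 * m * m + m := add_le_add (hdeg μ) (coeffDeg_defect μ)
    _ ≤ 3 * (m + 1) ^ 2 := by nlinarith

/-- **`MrCalibration` (item stmt-ValiantsHypothesis-5647 of route `RefutationDegree`).** For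
`n ≥ 3` and `2m + 1 ≤ n²`, the system `Rep(n,m)` has a Nullstellensatz refutation
`Σ_μ h_μ · coeff_μ P = 1` in which every product has degree `≤ 3 (m + 1)²` in the unknowns.
[cite: MignonRessayre2004, Thm. 1.1] -/
theorem mrCalibration_proof :
    Summit.ValiantsHypothesis.ValiantsHypothesis.Theses.RefutationDegree.MrCalibration := by
  have key : Summit.ValiantsHypothesis.ValiantsHypothesis.Theses.RefutationDegree.MrCalibration ↔
      (∃ c : ℕ, ∀ n m : ℕ, 3 ≤ n → 2 * m + 1 ≤ n ^ 2 →
        ∃ hh : (Fin n × Fin n →₀ ℕ) → MvPolynomial (Option (Fin n × Fin n) × (Fin m × Fin m)) ℂ,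
          (∀ μ, (hh μ * (defect[n, m]).coeff μ).totalDegree ≤ c * (m + 1) ^ 2) ∧
            ∑ μ ∈ (defect[n, m]).support, hh μ * (defect[n, m]).coeff μ = 1) :=
    Iff.rfl
  refine key.mpr ⟨3, fun n m hn hmn => ?_⟩
  obtain ⟨m', rfl⟩ : ∃ m', n = m' + 3 := ⟨n - 3, by omega⟩
  exact mrCalibration_aux m' m hmn

end Main

end Summit.ValiantsHypothesis.ValiantsHypothesis.Theorems
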